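import Summits.Ventures.DiscreteObjects.Hadamard.Order49FixedTen668
import Summits.Ventures.DiscreteObjects.Hadamard.PrimeSquareStructure668

/-!
# Hadamard 668 census, family F12 — order 25: the element fixes `8, 13, 18` or `23` rows and columns (kernel, structure)

Framing: lottery ticket; floor = certified bounds/negative ranges.

Cell pub-namedobj (venture DiscreteObjects), target (H), hadamard gen 17.  `PrimeSquareStructure668` leaves
`#Fix ∈ {3, 8, 13, 18, 23}` for the permutation parts of a signed automorphism of an H(668) of pair-order `25`.  The
value `3` is removed by (E3) in the kernel (`fixedRows_inner_dvd`: two `π`-fixed rows of equal sign have inner product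
`≡ 0 (mod 5)` over the `κ`-fixed columns; over `3` columns a `±1`-sum is `±1` or `±3`):
**`hadamard668_order25_fixed`** — `#Fix(π), #Fix(κ) ∈ {8, 13, 18, 23}`.  Structure only; order `25` is not excluded.
Ours, not literature; no `sorry`.
-/

namespace Summit.Ventures.DiscreteObjects.Hadamard

open Finset BigOperators Matrix

open Literature.Combinatorics.Designs.GoethalsSeidel (IsHadamardMatrix)

variable {ι : Type*} [Fintype ι] [DecidableEq ι]

section order25
variable {H : Matrix ι ι ℤ}

/-- columns, order 25: `#Fix(κ) ≠ 3` by (E3) -/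
lemma order25_cols_ne_three (hH : IsHadamardMatrix H) (hι : Fintype.card ι = 668)
    {π κ : Equiv.Perm ι} {d e : ι → ℤ} (haut : IsSignedAut H π κ d e)
    (hπ : π ^ 25 = 1) (hκ : κ ^ 25 = 1) (hκ5 : κ ^ 5 ≠ 1) :
    (univ.filter fun j => κ j = j).card ≠ 3 := by
  have hcard : (Fintype.card ι : ℤ) ≠ 0 := by rw [hι]; norm_num
  intro h3
  obtain ⟨-, hR, -⟩ := order25_cols (isHadamard_transpose hH hcard) hι (isSignedAut_transpose haut) hκ hπ hκ5
  -- two distinct π-fixed rows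
  have h2 : 1 < (univ.filter fun i => π i = i).card := by rcases hR with h | h | h | h | h <;> omega
  obtain ⟨x, hx, x', hx', hxx'⟩ := Finset.one_lt_card.mp h2
  simp only [Finset.mem_filter, Finset.mem_univ, true_and] at hx hx'
  have h0 : 0 < (univ.filter fun j => κ j = j).card := by omega
  obtain ⟨j₀, hj₀⟩ := Finset.card_pos.mp h0
  simp only [Finset.mem_filter, Finset.mem_univ, true_and] at hj₀
  have hdd : d x = d x' := by
    rw [signedAut_fixed_sign hH.1 haut hx hj₀, signedAut_fixed_sign hH.1 haut hx' hj₀]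
  have hκ' : κ ^ (5 * 5) = 1 := hκ
  have hdvd := fixedRows_inner_dvd hH haut (by norm_num : (5 : ℕ).Prime) hκ' hxx' hx hx' hdd
  obtain ⟨m, hm, hsum⟩ := sum_pm_eq_card_sub_two_mul (univ.filter fun j => κ j = j) (fun y => H x y * H x' y)
    (fun y _ => by
      rcases hH.1 x y with h1 | h1 <;> rcases hH.1 x' y with h2 | h2 <;> simp [h1, h2])
  rw [hsum, h3] at hdvd
  rw [h3] at hm
  obtain ⟨c, hc⟩ := hdvd
  push_cast at hc
  omega

/-- **order 25: the element fixes `8, 13, 18` or `23` rows and `8, 13, 18` or `23` columns** — for a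
signed automorphism `(π, κ, d, e)` of an H(668) with `π^25 = κ^25 = 1` and `(π^5, κ^5) ≠ (1, 1)`. -/
theorem hadamard668_order25_fixed (hH : IsHadamardMatrix H) (hι : Fintype.card ι = 668)
    (π κ : Equiv.Perm ι) (d e : ι → ℤ) (haut : IsSignedAut H π κ d e)
    (hπ : π ^ 25 = 1) (hκ : κ ^ 25 = 1) (hne : π ^ 5 ≠ 1 ∨ κ ^ 5 ≠ 1) :
    ((univ.filter fun i => π i = i).card = 8 ∨ (univ.filter fun i => π i = i).card = 13 ∨
      (univ.filter fun i => π i = i).card = 18 ∨ (univ.filter fun i => π i = i).card = 23) ∧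
    ((univ.filter fun j => κ j = j).card = 8 ∨ (univ.filter fun j => κ j = j).card = 13 ∨
      (univ.filter fun j => κ j = j).card = 18 ∨ (univ.filter fun j => κ j = j).card = 23) := by
  have hcard : (Fintype.card ι : ℤ) ≠ 0 := by rw [hι]; norm_num
  have hHt : IsHadamardMatrix Hᵀ := isHadamard_transpose hH hcard
  have haut5 := isSignedAut_pow haut 5
  have hπ55 : (π ^ 5) ^ 5 = 1 := by rw [← pow_mul]; exact hπ
  have hκ55 : (κ ^ 5) ^ 5 = 1 := by rw [← pow_mul]; exact hκ
  have hπ5 : π ^ 5 ≠ 1 := by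
    rcases hne with h | h
    · exact h
    · intro h5; apply h; rw [h5] at haut5
      exact signedAut_snd_eq_one H hH hcard haut5 (by decide : Odd 5) hκ55
  have hκ5 : κ ^ 5 ≠ 1 := by
    intro h5; apply hπ5
    have ht := isSignedAut_transpose haut5
    rw [h5] at ht
    exact signedAut_snd_eq_one Hᵀ hHt hcard ht (by decide : Odd 5) hπ55
  obtain ⟨-, -, hR, hC, -, -⟩ := hadamard668_order25_structure hH hι π κ d e haut hπ hκ hne
  have h3C := order25_cols_ne_three hH hι haut hπ hκ hκ5
  have h3R := order25_cols_ne_three hHt hι (isSignedAut_transpose haut) hκ hπ hπ5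
  constructor
  · rcases hR with h | h | h | h | h
    · exact absurd h h3R
    · exact Or.inl h
    · exact Or.inr (Or.inl h)
    · exact Or.inr (Or.inr (Or.inl h))
    · exact Or.inr (Or.inr (Or.inr h))
  · rcases hC with h | h | h | h | h
    · exact absurd h h3C
    · exact Or.inl h
    · exact Or.inr (Or.inl h)
    · exact Or.inr (Or.inr (Or.inl h))
    · exact Or.inr (Or.inr (Or.inr h))

end order25

end Summit.Ventures.DiscreteObjects.Hadamard
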